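import Summits.ValiantsHypothesis.ValiantsHypothesis.Theorems.LacunarySymmetroidMatrixDescartesCensusSupportDescartes
import Summits.ValiantsHypothesis.ValiantsHypothesis.Theorems.LacunarySymmetroidMatrixDescartesStubDescartesCeiling
import Summits.ValiantsHypothesis.ValiantsHypothesis.Theorems.LacunarySymmetroidMatrixDescartesCensusDefs

/-!
# `MatrixDescartes` census — DOOR A at `(3,4)`: a Descartes-sharp pencil has four NONSINGULAR letters

HONEST FRAMING.  Object-search cell `pub-symmetroid`, route `LacunarySymmetroid`; beside ONE typed statement, the route item
`Theses.LacunarySymmetroid.DoorA34` (stmt-ValiantsHypothesis-19980) `= DoorA34 = PosRootLawAt 3 4 18`, OPEN and asserted nowhere.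
This file is the first («F1», cube-monomial) layer of any `V = 19` analysis at `(3,4)`, support-generically and in the
kernel: if a `4`-term `3 × 3` pencil `det (∑ l, X^(d l) • S l)` (ANY real matrices, ANY exponents) has `19` distinct positive
roots, then its determinant has exactly the `20` monomials `X^(d i + d j + d k)` of the triple-sum table
(`support_det_pencil_eq_of_nineteen`; so the support is 3-Sidon, `cube_unique_of_nineteen`), the coefficient of `X^(3·d l)`
is `det (S l)` (`coeff_det_pencil_three_mul`), hence **every letter is nonsingular** (`det_letter_ne_zero_of_nineteen`).
Contrapositive — the SINGULAR-LETTER SECTOR of `DoorA34`: if some `det (S l) = 0` then `Z₊ ≤ 18` (`posRoots_le_18_of_det_letter_eq_zero`).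
Why the cell records it: every certified `(3,4)` pencil with `≥ 17` roots has an END letter within `10⁻⁹` of the singular
stratum (engine-4 `MP34.md` §2.3, «end-letter thinness»), i.e. the census maximisers hug exactly the closed set on which the
door-A row is forced by term count.  Symmetry of the `S l` is NOT used; nothing here bounds `ζ_sym(3,4)` on the open
stratum, and nothing bears on `MatrixDescartes` (stmt-ValiantsHypothesis-18050) or `VP ≠ VNP`.

[folklore] Leibniz expansion + the sparse Descartes rule; elementary.
-/

-- `Summit.ValiantsHypothesis.ValiantsHypothesis.…` repeats a component by the D-0017 layout
-- (single-conjunct summit), which the `dupNamespace` linter flags; the name is mandated.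
set_option linter.dupNamespace false

namespace Summit.ValiantsHypothesis.ValiantsHypothesis.Theorems.LacunarySymmetroidMatrixDescartes.Census

open Polynomial Finset
open scoped BigOperators Polynomial Matrix

/-- **Coefficient formula for a lacunary pencil determinant** (any format): the coefficient of `X^n` in
`det (∑ l, X^(d l) • S l)` is the signed Leibniz sum over the row-to-letter maps `f` with `∑ᵢ d (f i) = n`. [folklore] -/
theorem coeff_det_pencil {K m : ℕ} (d : Fin K → ℕ) (S : Fin K → Matrix (Fin m) (Fin m) ℝ) (n : ℕ) :
    (Matrix.det (∑ l, ((X : ℝ[X]) ^ d l) • (S l).map C)).coeff n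
      = ∑ σ : Equiv.Perm (Fin m), ∑ f : Fin m → Fin K,
          if n = ∑ i, d (f i) then ((Equiv.Perm.sign σ : ℤ) : ℝ) * ∏ i, S (f i) (σ i) i else 0 := by
  rw [StubDescartesCeiling.det_pencil_eq, finsetSum_coeff]
  refine Finset.sum_congr rfl fun σ _ => ?_
  rw [finsetSum_coeff]
  refine Finset.sum_congr rfl fun f _ => ?_
  rw [← C_eq_intCast, ← mul_assoc, ← C_mul, coeff_C_mul_X_pow]

/-- **The cube monomial carries `det (S l)`**: if `3·d l` is represented only by `{l,l,l}` among the triple sums of `d`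
(automatic on a 3-Sidon support), the coefficient of `X^(3·d l)` in the pencil determinant is `det (S l)`. [folklore] -/
theorem coeff_det_pencil_three_mul (d : Fin 4 → ℕ) (S : Fin 4 → Matrix (Fin 3) (Fin 3) ℝ) (l : Fin 4)
    (h3 : ∀ f : Fin 3 → Fin 4, (∑ i, d (f i)) = 3 * d l → ∀ i, f i = l) :
    (Matrix.det (∑ k, ((X : ℝ[X]) ^ d k) • (S k).map C)).coeff (3 * d l) = (S l).det := by
  rw [coeff_det_pencil, Matrix.det_apply']
  refine Finset.sum_congr rfl fun σ _ => ?_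
  rw [Finset.sum_eq_single (fun _ => l)]
  · have hs : (∑ _i : Fin 3, d l) = 3 * d l := by simp [Finset.sum_const]
    simp only [hs, if_true]
  · intro f _ hf
    rw [if_neg]
    intro h
    exact hf (funext fun i => h3 f h.symm i)
  · intro h
    exact absurd (Finset.mem_univ _) h

/-- **`19` positive roots force all `20` monomials**: the support of the determinant of a `4`-term `3 × 3` pencil with
`19` distinct positive roots is the whole image of `Sym (Fin 4) 3` under `s ↦ ∑_{l ∈ s} d l` (`20` multisets), by the sparse
Descartes rule (`19 < #support ≤ 20`). [folklore] -/
theorem support_det_pencil_eq_of_nineteen (d : Fin 4 → ℕ) (S : Fin 4 → Matrix (Fin 3) (Fin 3) ℝ)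
    (h19 : 19 ≤ ((Matrix.det (∑ l, ((X : ℝ[X]) ^ d l) • (S l).map C)).roots.toFinset.filter (fun t => 0 < t)).card) :
    (Matrix.det (∑ l, ((X : ℝ[X]) ^ d l) • (S l).map C)).support
      = (Finset.univ : Finset (Sym (Fin 4) 3)).image (fun s : Sym (Fin 4) 3 => ((s : Multiset (Fin 4)).map d).sum) := by
  have hP : Matrix.det (∑ l, ((X : ℝ[X]) ^ d l) • (S l).map C) ≠ 0 := by
    intro h
    rw [h, Polynomial.roots_zero, Multiset.toFinset_zero, Finset.filter_empty, Finset.card_empty] at h19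
    omega
  have hlt := Literature.Computability.AlgebraicComplexity.card_roots_toFinset_filter_pos_lt_card_support hP
  have hsub := StubDescartesCeiling.support_det_pencil_subset d S
  have hcard : ((Finset.univ : Finset (Sym (Fin 4) 3)).image
      (fun s : Sym (Fin 4) 3 => ((s : Multiset (Fin 4)).map d).sum)).card ≤ 20 :=
    Finset.card_image_le.trans (by rw [Finset.card_univ, Sym.card_sym_eq_choose]; decide)
  exact Finset.eq_of_subset_of_card_le hsub (by omega)

/-- With `19` positive roots the `20` multiset sums are pairwise distinct (the support is 3-Sidon): `s ↦ ∑_{l∈s} d l` is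
injective on `Sym (Fin 4) 3`. [folklore] -/
theorem sym_sum_injective_of_nineteen (d : Fin 4 → ℕ) (S : Fin 4 → Matrix (Fin 3) (Fin 3) ℝ)
    (h19 : 19 ≤ ((Matrix.det (∑ l, ((X : ℝ[X]) ^ d l) • (S l).map C)).roots.toFinset.filter (fun t => 0 < t)).card) :
    Function.Injective (fun s : Sym (Fin 4) 3 => ((s : Multiset (Fin 4)).map d).sum) := by
  have hP : Matrix.det (∑ l, ((X : ℝ[X]) ^ d l) • (S l).map C) ≠ 0 := by
    intro h
    rw [h, Polynomial.roots_zero, Multiset.toFinset_zero, Finset.filter_empty, Finset.card_empty] at h19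
    omega
  have hlt := Literature.Computability.AlgebraicComplexity.card_roots_toFinset_filter_pos_lt_card_support hP
  have heq := support_det_pencil_eq_of_nineteen d S h19
  have h20 : (Finset.univ : Finset (Sym (Fin 4) 3)).card = 20 := by
    rw [Finset.card_univ, Sym.card_sym_eq_choose]; decide
  have hinj : Set.InjOn (fun s : Sym (Fin 4) 3 => ((s : Multiset (Fin 4)).map d).sum) ↑(Finset.univ : Finset (Sym (Fin 4) 3)) := by
    rw [← Finset.card_image_iff]
    refine le_antisymm Finset.card_image_le ?_
    rw [← heq, h20]
    omega
  intro s₁ s₂ h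
  exact hinj (Finset.mem_coe.2 (Finset.mem_univ _)) (Finset.mem_coe.2 (Finset.mem_univ _)) h

/-- `19` positive roots ⇒ the cube exponent `3·d l` is represented only by `{l,l,l}`. [folklore] -/
theorem cube_unique_of_nineteen (d : Fin 4 → ℕ) (S : Fin 4 → Matrix (Fin 3) (Fin 3) ℝ)
    (h19 : 19 ≤ ((Matrix.det (∑ l, ((X : ℝ[X]) ^ d l) • (S l).map C)).roots.toFinset.filter (fun t => 0 < t)).card)
    (l : Fin 4) : ∀ f : Fin 3 → Fin 4, (∑ i, d (f i)) = 3 * d l → ∀ i, f i = l := by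
  intro f hf i
  have hinj := sym_sum_injective_of_nineteen d S h19
  have hsum : (((⟨Finset.univ.val.map f, StubDescartesCeiling.card_map_univ_val f⟩ : Sym (Fin 4) 3) : Multiset (Fin 4)).map d).sum
      = (((Sym.replicate 3 l : Sym (Fin 4) 3) : Multiset (Fin 4)).map d).sum := by
    rw [Sym.coe_replicate, Multiset.map_replicate, Multiset.sum_replicate, smul_eq_mul, ← hf,
      StubDescartesCeiling.sum_eq_sym_sum]
  have h1 := hinj hsum
  have hmem : f i ∈ (Finset.univ.val.map f : Multiset (Fin 4)) := Multiset.mem_map_of_mem f (Finset.mem_univ_val i)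
  have hval : (Finset.univ.val.map f : Multiset (Fin 4)) = Multiset.replicate 3 l := by
    have := congrArg (fun s : Sym (Fin 4) 3 => (s : Multiset (Fin 4))) h1
    simpa [Sym.coe_replicate] using this
  rw [hval] at hmem
  exact Multiset.eq_of_mem_replicate hmem

/-- `19` positive roots ⇒ `X^(3·d l)` is a monomial of the determinant. [folklore] -/
theorem three_mul_mem_support_of_nineteen (d : Fin 4 → ℕ) (S : Fin 4 → Matrix (Fin 3) (Fin 3) ℝ)
    (h19 : 19 ≤ ((Matrix.det (∑ l, ((X : ℝ[X]) ^ d l) • (S l).map C)).roots.toFinset.filter (fun t => 0 < t)).card)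
    (l : Fin 4) : 3 * d l ∈ (Matrix.det (∑ k, ((X : ℝ[X]) ^ d k) • (S k).map C)).support := by
  rw [support_det_pencil_eq_of_nineteen d S h19]
  refine Finset.mem_image.mpr ⟨Sym.replicate 3 l, Finset.mem_univ _, ?_⟩
  simp only [Sym.coe_replicate, Multiset.map_replicate, Multiset.sum_replicate, smul_eq_mul]

/-- **A Descartes-sharp `(3,4)` pencil has four NONSINGULAR letters.**  If `det (∑ l, X^(d l) • S l)` (any real `3 × 3`
matrices `S l`, any exponents) has `19` distinct positive roots, then `det (S l) ≠ 0` for every `l`: the cube monomial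
`X^(3·d l)` must be present and its coefficient is `det (S l)`. [folklore] -/
theorem det_letter_ne_zero_of_nineteen (d : Fin 4 → ℕ) (S : Fin 4 → Matrix (Fin 3) (Fin 3) ℝ)
    (h19 : 19 ≤ ((Matrix.det (∑ l, ((X : ℝ[X]) ^ d l) • (S l).map C)).roots.toFinset.filter (fun t => 0 < t)).card)
    (l : Fin 4) : (S l).det ≠ 0 := by
  have hmem := three_mul_mem_support_of_nineteen d S h19 l
  rw [mem_support_iff, coeff_det_pencil_three_mul d S l (cube_unique_of_nineteen d S h19 l)] at hmem
  exact hmem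

/-- **The singular-letter sector of `DoorA34`.**  If some letter of a `4`-term real `3 × 3` pencil is SINGULAR
(`det (S l) = 0`), its determinant has at most `18` distinct positive roots — on every support, symmetric or not.  This is
the closed stratum next to which every census maximiser of record sits (end letters within `10⁻⁹` of singular); the door-A
question `ζ_sym(3,4) ≤ 18` lives on its open complement. [folklore] -/
theorem posRoots_le_18_of_det_letter_eq_zero (d : Fin 4 → ℕ) (S : Fin 4 → Matrix (Fin 3) (Fin 3) ℝ) (l : Fin 4)
    (hl : (S l).det = 0) :
    ((Matrix.det (∑ k, ((X : ℝ[X]) ^ d k) • (S k).map C)).roots.toFinset.filter (fun t => 0 < t)).card ≤ 18 := by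
  by_contra h
  exact det_letter_ne_zero_of_nineteen d S (by omega) l hl

/-- Row currency: on every support, the door-A bound `ζ(3,4; d) ≤ 18` holds for all SYMMETRIC pencils with a singular
letter (the instance of the previous theorem the cell's table quotes). [folklore] -/
theorem doorA34_on_singular_letter (d : Fin 4 → ℕ) (S : Fin 4 → Matrix (Fin 3) (Fin 3) ℝ)
    (_hS : ∀ l, (S l).IsSymm) (h : ∃ l, (S l).det = 0) :
    ((∑ k, (X : ℝ[X]) ^ d k • (S k).map C).det.roots.toFinset.filter (fun t => 0 < t)).card ≤ 18 := by
  obtain ⟨l, hl⟩ := h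
  exact posRoots_le_18_of_det_letter_eq_zero d S l hl

end Summit.ValiantsHypothesis.ValiantsHypothesis.Theorems.LacunarySymmetroidMatrixDescartes.Census
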